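import Summits.ValiantsHypothesis.ValiantsHypothesis.Theses.SymmetroidDescartes

/-!
# Crux `DerivedPencilRolleQuasi` (stmt-ValiantsHypothesis-18064) — ideator 2, round 1: first lemmas of two idea cards

* Card `hajos-krylov-valuation`: the (t-1)-adic VALUATION `val₁(f) = rootMultiplicity 1 (det F)` as the algebraic
  shadow of the root count; multiplicity-counted strengthening `QuasiBoundMult` (C⁺) ⇒ crux (proved here, `C = 0`)
  and ⇒ `HajosRung` (proved here); scalar first rung = Hajós' lemma (PROVED here, `Hajos.hajos` / `hajos_rung`);
  `ValuativeDimensionLaw` (conjecture).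
* Card `monotone-freezing`: general real pencils `T₀ + Σ_{l≥1} X^{d_l} T_l` with PSD tail; `MonotoneFreezing`
  (conjecture, strong and weak forms); first rung = symmetric head (Loewner monotonicity, stub).
-/

set_option linter.dupNamespace false
set_option linter.unusedVariables false
set_option linter.unusedTactic false

/-! ## Hajós' lemma (first rung of card 1), fully proved -/

namespace Summit.ValiantsHypothesis.ValiantsHypothesis.Cruxes.DerivedPencilRolleQuasi.Ideator2.Hajos

open Polynomial Finset
open scoped BigOperators

/-- `(X-1)^N ∣ p` implies `(X-1)^(N-1) ∣ X·p' − c·p`. -/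
theorem dvd_euler {p : ℝ[X]} {N : ℕ} (c : ℝ) (h : (X - C 1) ^ N ∣ p) :
    (X - C 1) ^ (N - 1) ∣ X * derivative p - C c * p := by
  obtain ⟨r, rfl⟩ := h
  rcases Nat.eq_zero_or_pos N with hN | hN
  · subst hN
    simp
  · obtain ⟨M, rfl⟩ : ∃ M, N = M + 1 := ⟨N - 1, by omega⟩
    have hM : M + 1 - 1 = M := by omega
    rw [hM]
    refine ⟨X * (C ((M : ℝ) + 1) * r + (X - C 1) * derivative r) - C c * ((X - C 1) * r), ?_⟩
    rw [derivative_mul, derivative_pow_succ, derivative_sub, derivative_X, derivative_C, sub_zero,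
      mul_one]
    ring

/-- The order at `1` drops by at most one under the twisted Euler operator (when the image is nonzero). -/
theorem rootMultiplicity_le_euler_succ {p : ℝ[X]} (c : ℝ) (hq : X * derivative p - C c * p ≠ 0) :
    p.rootMultiplicity 1 ≤ (X * derivative p - C c * p).rootMultiplicity 1 + 1 := by
  have hdvd : (X - C (1 : ℝ)) ^ (p.rootMultiplicity 1) ∣ p := pow_rootMultiplicity_dvd p 1
  have h2 := dvd_euler c hdvd
  have h3 : p.rootMultiplicity 1 - 1 ≤ (X * derivative p - C c * p).rootMultiplicity 1 :=
    (le_rootMultiplicity_iff hq).mpr h2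
  omega

/-- The twisted Euler operator on one monomial. -/
theorem euler_monomial (a c : ℝ) (n : ℕ) :
    X * derivative (C a * X ^ n) - C c * (C a * X ^ n) = C (a * ((n : ℝ) - c)) * X ^ n := by
  rcases Nat.eq_zero_or_pos n with hn | hn
  · subst hn
    simp only [pow_zero, mul_one, derivative_C, mul_zero, zero_sub, Nat.cast_zero]
    rw [← C_mul, ← C_neg]
    congr 1
    ring
  · obtain ⟨m, rfl⟩ : ∃ m, n = m + 1 := ⟨n - 1, by omega⟩
    rw [derivative_C_mul_X_pow]
    simp only [Nat.add_sub_cancel, Nat.cast_add, Nat.cast_one, map_sub, map_mul]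
    ring

/-- The twisted Euler operator on a lacunary sum: same exponents, coefficients `a_l (d_l − c)`. -/
theorem euler_sum {ι : Type*} (s : Finset ι) (a : ι → ℝ) (d : ι → ℕ) (c : ℝ) :
    X * derivative (∑ l ∈ s, C (a l) * X ^ d l) - C c * (∑ l ∈ s, C (a l) * X ^ d l)
      = ∑ l ∈ s, C (a l * ((d l : ℝ) - c)) * X ^ d l := by
  rw [derivative_sum, Finset.mul_sum, Finset.mul_sum, ← Finset.sum_sub_distrib]
  refine Finset.sum_congr rfl fun l _ => ?_
  exact euler_monomial (a l) c (d l)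

/-- Coefficient extraction from a lacunary sum with injective exponents. -/
theorem coeff_lacunary {ι : Type*} [Fintype ι] [DecidableEq ι] (b : ι → ℝ) (e : ι → ℕ)
    (he : Function.Injective e) (j : ι) :
    (∑ l, C (b l) * X ^ e l).coeff (e j) = b j := by
  rw [finsetSum_coeff]
  simp only [coeff_C_mul_X_pow]
  rw [Finset.sum_eq_single j]
  · simp
  · intro l _ hlj
    rw [if_neg]
    exact fun h => hlj (he h.symm)
  · intro h
    exact absurd (Finset.mem_univ j) h

/-- A single nonzero monomial does not vanish at `1`. -/
theorem rootMultiplicity_monomial_one {a : ℝ} (ha : a ≠ 0) (n : ℕ) :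
    (C a * X ^ n).rootMultiplicity 1 = 0 := by
  rw [rootMultiplicity_eq_zero_iff]
  intro h
  exfalso
  simp [IsRoot] at h
  exact ha h

/-- **Hajós' lemma.**  A nonzero real polynomial with at most `K+1` terms has a zero of order at most `K`
at `1`. -/
theorem hajos (K : ℕ) : ∀ (a : Fin (K + 1) → ℝ) (d : Fin (K + 1) → ℕ), StrictMono d →
    (∑ l, C (a l) * (X : ℝ[X]) ^ d l) ≠ 0 →
      (∑ l, C (a l) * (X : ℝ[X]) ^ d l).rootMultiplicity 1 ≤ K := by
  induction K with
  | zero =>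
    intro a d hd hp
    have hsum : (∑ l, C (a l) * (X : ℝ[X]) ^ d l) = C (a 0) * X ^ d 0 := by
      rw [Fin.sum_univ_one]
    rw [hsum] at hp ⊢
    have ha : a 0 ≠ 0 := by
      intro h
      apply hp
      simp [h]
    rw [rootMultiplicity_monomial_one ha]
  | succ K ih =>
    intro a d hd hp
    set p : ℝ[X] := ∑ l, C (a l) * (X : ℝ[X]) ^ d l with hpdef
    -- the twisted Euler image, reindexed over `Fin (K+1)` (the `l = 0` term vanishes)
    have hq : X * derivative p - C ((d 0 : ℕ) : ℝ) * p
        = ∑ l : Fin (K + 1), C (a l.succ * ((d l.succ : ℝ) - (d 0 : ℝ))) * X ^ d l.succ := by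
      rw [hpdef, euler_sum, Fin.sum_univ_succ]
      simp
    have hd' : StrictMono (fun l : Fin (K + 1) => d l.succ) :=
      fun i j hij => hd (Fin.succ_lt_succ_iff.mpr hij)
    by_cases hq0 : X * derivative p - C ((d 0 : ℕ) : ℝ) * p = 0
    · -- then every higher coefficient vanishes and `p` is a single monomial
      rw [hq] at hq0
      have hcoef : ∀ j : Fin (K + 1), a j.succ = 0 := by
        intro j
        have h1 := congrArg (fun r : ℝ[X] => r.coeff (d j.succ)) hq0
        simp only [coeff_zero] at h1
        rw [coeff_lacunary (fun l : Fin (K + 1) => a l.succ * ((d l.succ : ℝ) - (d 0 : ℝ)))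
          (fun l : Fin (K + 1) => d l.succ) hd'.injective j] at h1
        have hne : ((d j.succ : ℕ) : ℝ) - (d 0 : ℝ) ≠ 0 := by
          have : d 0 < d j.succ := hd (Fin.succ_pos j)
          have : ((d 0 : ℕ) : ℝ) < (d j.succ : ℝ) := by exact_mod_cast this
          linarith
        exact (mul_eq_zero.mp h1).resolve_right hne
      have hp1 : p = C (a 0) * X ^ d 0 := by
        rw [hpdef, Fin.sum_univ_succ]
        simp [hcoef]
      have ha : a 0 ≠ 0 := by
        intro h
        apply hp
        change p = 0
        rw [hp1, h]
        simp
      change p.rootMultiplicity 1 ≤ K + 1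
      rw [hp1, rootMultiplicity_monomial_one ha]
      exact Nat.zero_le _
    · have h1 := rootMultiplicity_le_euler_succ ((d 0 : ℕ) : ℝ) hq0
      have h2 : (X * derivative p - C ((d 0 : ℕ) : ℝ) * p).rootMultiplicity 1 ≤ K := by
        rw [hq] at hq0 ⊢
        exact ih (fun l => a l.succ * ((d l.succ : ℝ) - (d 0 : ℝ))) (fun l => d l.succ) hd' hq0
      change p.rootMultiplicity 1 ≤ K + 1
      omega

end Summit.ValiantsHypothesis.ValiantsHypothesis.Cruxes.DerivedPencilRolleQuasi.Ideator2.Hajos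

namespace Summit.ValiantsHypothesis.ValiantsHypothesis.Cruxes.DerivedPencilRolleQuasi.Ideator2

open Polynomial Matrix Finset
open scoped BigOperators

/-- The lacunary pencil `Σ_l X^{d_l} • S_l` (verbatim the crux's expression). -/
noncomputable def pencil {K m : ℕ} (d : Fin K → ℕ) (S : Fin K → Matrix (Fin m) (Fin m) ℝ) :
    Matrix (Fin m) (Fin m) ℝ[X] :=
  ∑ l, (X : ℝ[X]) ^ d l • (S l).map C

/-- `Z₊`: number of distinct positive real roots of `det` of the pencil. -/
noncomputable def posRootCount {K m : ℕ} (d : Fin K → ℕ) (S : Fin K → Matrix (Fin m) (Fin m) ℝ) : ℕ :=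
  ((pencil d S).det.roots.toFinset.filter (fun t => 0 < t)).card

/-- `Z₊^mult`: positive real roots of `det` of the pencil counted WITH multiplicity. -/
noncomputable def posRootCountMult {K m : ℕ} (d : Fin K → ℕ) (S : Fin K → Matrix (Fin m) (Fin m) ℝ) : ℕ :=
  Multiset.card ((pencil d S).det.roots.filter (fun t => 0 < t))

/-- `val₁`: order of vanishing of `det` of the pencil at `t = 1` (the `(t-1)`-adic valuation). -/
noncomputable def val1 {K m : ℕ} (d : Fin K → ℕ) (S : Fin K → Matrix (Fin m) (Fin m) ℝ) : ℕ :=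
  (pencil d S).det.rootMultiplicity 1

/-! ## Card 1 — Hajós / Krylov-flag valuation -/

/-- **C⁺ (transfer target): the crux's bound for positive roots COUNTED WITH MULTIPLICITY** (`C = 0`, as every
multiplicity-blind technique — Descartes/variation-diminishing, Rolle, Wronskian/Voorhoeve — delivers). -/
def QuasiBoundMult : Prop :=
  ∃ A : ℕ, ∀ (m K : ℕ) (S : Fin (K + 1) → Matrix (Fin m) (Fin m) ℝ) (d : Fin (K + 1) → ℕ),
    (∀ l, (S l).IsSymm) → (∀ l, (S l).det ≠ 0) → StrictMono d →
      posRootCountMult d S ≤ (K + 1) ^ (A * K) * 2 ^ (Nat.log 2 m + 2) ^ A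

/-- **Hajós rung** = C⁺ with all roots at ONE point: the valuation at `t = 1` obeys the crux's budget.  Purely
algebraic (orthogonality of the coefficient tensor to a Krylov flag of the free diagonal Hamiltonian). -/
def HajosRung : Prop :=
  ∃ A : ℕ, ∀ (m K : ℕ) (S : Fin (K + 1) → Matrix (Fin m) (Fin m) ℝ) (d : Fin (K + 1) → ℕ),
    (∀ l, (S l).IsSymm) → (∀ l, (S l).det ≠ 0) → StrictMono d →
      val1 d S ≤ (K + 1) ^ (A * K) * 2 ^ (Nat.log 2 m + 2) ^ A

/-- **Valuative dimension law** (the card's sharp conjecture, polynomial form): the valuation at `1` of a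
nonzero lacunary pencil determinant is polynomial in `(m, K)` — conjecturally `≤ dim` of the class variety
`≤ (K+1)m²` up to an `O(1)` special-position defect (E1: `val_max(2,4) = 13 = 4K-3` certified; `(2,5) ≤ 18`). -/
def ValuativeDimensionLaw : Prop :=
  ∃ A : ℕ, ∀ (m K : ℕ) (S : Fin (K + 1) → Matrix (Fin m) (Fin m) ℝ) (d : Fin (K + 1) → ℕ),
    StrictMono d → (pencil d S).det ≠ 0 → val1 d S ≤ ((K + 2) * (m + 1)) ^ A

/-- FIRST LEMMA (scalar rung, `m = 1`): **Hajós' lemma** — a nonzero real polynomial with at most `K+1` terms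
vanishes at `1` to order at most `K`.  PROVED (namespace `Hajos` above: twisted Euler operator `X·d/dX − d₀` kills the
lowest term and lowers the order at `1` by at most one; induction on `K`).
[Hajós 1953; Chattopadhyay–Grenet–Koiran–Portier–Strozecki arXiv:1206.4224 §2] -/
theorem hajos_rung (K : ℕ) (a : Fin (K + 1) → ℝ) (d : Fin (K + 1) → ℕ) (hd : StrictMono d)
    (h : (∑ l, Polynomial.C (a l) * (X : ℝ[X]) ^ d l) ≠ 0) :
    (∑ l, Polynomial.C (a l) * (X : ℝ[X]) ^ d l).rootMultiplicity 1 ≤ K :=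
  Hajos.hajos K a d hd h

/-- C⁺ ⇒ the crux (with `C = 0`): distinct roots are at most roots with multiplicity. -/
theorem quasiBoundMult_imp_crux (h : QuasiBoundMult) :
    Summit.ValiantsHypothesis.ValiantsHypothesis.Theses.SymmetroidDescartes.DerivedPencilRolleQuasi := by
  obtain ⟨A, hA⟩ := h
  refine ⟨0, A, ?_⟩
  intro m K S d hS hdet hd
  have h1 := hA m K S d hS hdet hd
  have h2 : ((pencil d S).det.roots.toFinset.filter (fun t => 0 < t)).card ≤ posRootCountMult d S := by
    unfold posRootCountMult
    rw [← Multiset.toFinset_filter]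
    exact Multiset.toFinset_card_le _
  have h3 : ((∑ l, (Polynomial.X : Polynomial ℝ) ^ d l • (S l).map Polynomial.C).det.roots.toFinset.filter
      (fun t => 0 < t)).card ≤ (K + 1) ^ (A * K) * 2 ^ (Nat.log 2 m + 2) ^ A := h2.trans h1
  simpa using h3

/-- C⁺ ⇒ the Hajós rung: the multiplicity of the root `1` is at most the number of positive roots with
multiplicity. -/
theorem quasiBoundMult_imp_hajosRung (h : QuasiBoundMult) : HajosRung := by
  obtain ⟨A, hA⟩ := h
  refine ⟨A, ?_⟩
  intro m K S d hS hdet hd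
  have h1 := hA m K S d hS hdet hd
  have h2 : val1 d S ≤ posRootCountMult d S := by
    unfold val1 posRootCountMult
    rw [← Polynomial.count_roots]
    rw [← Multiset.count_filter_of_pos (p := fun t : ℝ => 0 < t) (by norm_num : (0 : ℝ) < 1)]
    exact Multiset.count_le_card _ _
  exact h2.trans h1

/-! ## Card 2 — monotone freezing (general real head + PSD lacunary tail) -/

/-- The monotone class: `G(t) = T₀ + Σ_l X^{d_l} • T_l`, `T₀` ARBITRARY real (symmetry is idle by the doubling
`[[0,G],[Gᵀ,0]]`, refuter 2026-08-17), `T_l ⪰ 0`, `d_l ≥ 1`: a bound `B k K` on its distinct positive roots. -/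
def MonotoneClassBound (B : ℕ → ℕ → ℕ) : Prop :=
  ∀ (k K : ℕ) (T₀ : Matrix (Fin k) (Fin k) ℝ) (T : Fin K → Matrix (Fin k) (Fin k) ℝ) (d : Fin K → ℕ),
    (∀ l, (T l).PosSemidef) → (∀ l, 0 < d l) → StrictMono d →
      ((T₀.map C + ∑ l, (X : ℝ[X]) ^ d l • (T l).map C).det.roots.toFinset.filter (fun t => 0 < t)).card
        ≤ B k K

/-- **Monotone-freezing conjecture, strong form**: polynomial in the size `k`, INDEPENDENT of the number of terms
(the freezing flag `V(t) ⊇ V(t')` has length `≤ k`; spectral staircase saturates `k(k+1)/2` at `K = 2`). -/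
def MonotoneFreezing : Prop := ∃ A : ℕ, MonotoneClassBound (fun k _ => (k + 2) ^ A)

/-- **Monotone-freezing conjecture, weak form**: polynomial in `(k, K)` — still exponentially inside the crux's
budget on the class where the Rolle term is idle and the only archimedean amplifier on file lives. -/
def MonotoneFreezingWeak : Prop := ∃ A : ℕ, MonotoneClassBound (fun k K => ((k + 2) * (K + 2)) ^ A)

/-- FIRST LEMMA (the solved head, for calibration of the line): a SYMMETRIC head makes the whole pencil
Loewner-monotone up to the constant `T₀`, so every eigenvalue branch of `T₀ + P(t)` is non-decreasing and
`Z₊ ≤ k` (the PSD/Loewner sector; Courant–Fischer).  The card's content is the NON-symmetric head. -/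
theorem stub_loewner_rung (k K : ℕ) (T₀ : Matrix (Fin k) (Fin k) ℝ) (hT₀ : T₀.IsSymm)
    (T : Fin K → Matrix (Fin k) (Fin k) ℝ) (hT : ∀ l, (T l).PosSemidef) (d : Fin K → ℕ) (hd : ∀ l, 0 < d l)
    (hne : (T₀.map C + ∑ l, (X : ℝ[X]) ^ d l • (T l).map C).det ≠ 0) :
    ((T₀.map C + ∑ l, (X : ℝ[X]) ^ d l • (T l).map C).det.roots.toFinset.filter (fun t => 0 < t)).card ≤ k := by
  sorry

theorem monotoneFreezing_imp_weak (h : MonotoneFreezing) : MonotoneFreezingWeak := by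
  obtain ⟨A, hA⟩ := h
  refine ⟨A, fun k K T₀ T d hT hd hmono => (hA k K T₀ T d hT hd hmono).trans ?_⟩
  exact Nat.pow_le_pow_left (Nat.le_mul_of_pos_right _ (by omega)) A

end Summit.ValiantsHypothesis.ValiantsHypothesis.Cruxes.DerivedPencilRolleQuasi.Ideator2
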